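import Summits.HubbardSuperconductivity.HubbardSuperconductivity.Theorems.LogColdTorusAverageToEveryClosures
import Summits.HubbardSuperconductivity.HubbardSuperconductivity.Theorems.BalabanIRBirEveryGroundStateSocket
import HarnessLib

/-!
# Route `LogColdTorus`, crux `AverageToEvery` (item `stmt-HubbardSuperconductivity-10519`, shared with route
`AbelianDuality`): the crux IS its transfer form (exact content of the conclusion)

Helper (`--supports`) for the crux
`Summit.HubbardSuperconductivity.HubbardSuperconductivity.Theses.LogColdTorus.AverageToEvery`.

* `not_isGroundStateInSector_of_lt_neg_one` — for `δ < -1` the prescribed particle number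
  `N_L = 2⌊(1-δ)L²/2⌋` exceeds the number `2L²` of spin-orbitals of the torus from some side on,
  so the `(N_L, S^z = 0)` sector is `⊥` and there are NO sector ground states (the crux and its
  transfer form are both vacuous there).
* `averageToEvery_iff_transfer` — **`AverageToEvery` is EQUIVALENT to its transfer form**: for all
  `(δ, U₁, U₂, c, L₀)` with `0 < U₁ < U₂`, `0 < c`, the window hypothesis (block ground-state
  average of `Δ_d† Δ_d` at least `c L⁴` for all `U ∈ (U₁, U₂)` and all even `L ≥ L₀`) yields a
  coupling `U ∈ (U₁, U₂)`, a constant `a > 0` and a threshold `L₁` with the every-ground-state bound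
  `a L⁴ ≤ re ⟨ψ, Δ_d† Δ_d ψ⟩` for every normalised sector ground state at every even `L ≥ L₁`.
  (⇐ is the landed `averageToEvery_of_everyGroundState_transfer`; ⇒ applies the crux and converts
  the long-range order of every admissible sequence at the produced coupling into the uniform bound
  by the landed `groundState_bound_of_forall_hasLRO` (worst ground states, `δ ≥ -1`), the case
  `δ < -1` being vacuous.) So the crux is EXACTLY "window average ⇒ at one coupling of the window,
  an eventual uniform `L⁴` lower bound on the bottom of the compression of `Δ_d† Δ_d` to the sector
  ground eigenspace" — the statement every mechanism (genericity + Schur, κ-chord, uniqueness) must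
  deliver, cf. the sibling `birEveryGroundState_iff_transfer`.

Scalapino, Phys. Rep. 250 (1995) 329, §2 eq. (2.4); Friedli–Velenik (2017) §3.7.2. Folklore; no
definition is introduced.
-/

noncomputable section

-- `dupNamespace`: the summit and the problem are both named `HubbardSuperconductivity` (layout D-0022)
set_option linter.dupNamespace false

namespace Summit.HubbardSuperconductivity.HubbardSuperconductivity.Theorems

open Matrix Finset Filter
open Literature.Probability.LatticeModels Literature.MathematicalPhysics.QuantumLattice
open scoped ComplexOrder Matrix Classical

/-- **No sector ground states beyond full filling.** For `δ < -1` there is a side `L₁` such that for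
every `L ≥ L₁` the joint sector `(2⌊(1-δ)L²/2⌋, S^z = 0)` of the torus of side `L` contains no
ground state of any Hamiltonian: `2⌊(1-δ)L²/2⌋ > 2L² = |Orb|`, so an `N_L`-particle vector vanishes
identically (`IsNParticle`), contradicting `ψ ≠ 0`. [folklore] -/
theorem not_isGroundStateInSector_of_lt_neg_one {δ : ℝ} (hδ : δ < -1) :
    ∃ L₁ : ℕ, ∀ (L : ℕ), L₁ ≤ L → ∀ (H : Matrix (Finset (Orb (FermionTorus 2 L)))
      (Finset (Orb (FermionTorus 2 L))) ℂ) (ψ : Fock (Orb (FermionTorus 2 L))),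
      ¬ IsGroundStateInSector H (2 * ⌊(1 - δ) * (L : ℝ) ^ 2 / 2⌋₊) 0 ψ := by
  -- choose `L₁` with `(-1 - δ) L₁ ≥ 2`, so that `(1 - δ) L² / 2 ≥ L² + 1` for `L ≥ L₁`
  obtain ⟨L₁, hL₁⟩ := exists_nat_ge (2 / (-1 - δ))
  have hε : 0 < -1 - δ := by linarith
  refine ⟨max L₁ 1, fun L hL H ψ hgs => ?_⟩
  have hL1 : (1 : ℝ) ≤ (L : ℝ) := by exact_mod_cast (le_max_right L₁ 1).trans hL
  have hLL : (L₁ : ℝ) ≤ (L : ℝ) := by exact_mod_cast (le_max_left L₁ 1).trans hL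
  -- the particle number exceeds the number of spin-orbitals
  have hbig : 2 * L ^ 2 + 2 ≤ 2 * ⌊(1 - δ) * (L : ℝ) ^ 2 / 2⌋₊ := by
    have h1 : (L : ℝ) ^ 2 + 1 ≤ (1 - δ) * (L : ℝ) ^ 2 / 2 := by
      have h2 : 2 ≤ (-1 - δ) * (L : ℝ) := by
        have := (div_le_iff₀ hε).1 (hL₁.trans hLL)
        linarith
      have h3 : (-1 - δ) * (L : ℝ) ≤ (-1 - δ) * (L : ℝ) ^ 2 := by
        have : (L : ℝ) ≤ (L : ℝ) ^ 2 := by nlinarith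
        exact mul_le_mul_of_nonneg_left this hε.le
      nlinarith
    have h4 : L ^ 2 + 1 ≤ ⌊(1 - δ) * (L : ℝ) ^ 2 / 2⌋₊ := by
      refine Nat.le_floor ?_
      push_cast
      exact h1
    omega
  -- an `N`-particle vector with `N > |Orb|` vanishes
  obtain ⟨hmem, hne, -⟩ := hgs
  rw [mem_szSector_iff] at hmem
  refine hne (funext fun s => hmem.1 s ?_)
  have hcard : s.card ≤ 2 * L ^ 2 := by
    have hΛ : Fintype.card (FermionTorus 2 L) = L ^ 2 := by
      change Fintype.card (Fin 2 → Fin L) = L ^ 2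
      rw [Fintype.card_fun, Fintype.card_fin, Fintype.card_fin]
    have h := Finset.card_le_univ s
    rw [card_orb, hΛ] at h
    omega
  omega

/-- **`AverageToEvery` ⇔ its transfer form.** The crux `LogColdTorus.AverageToEvery` is equivalent
to: for all `(δ, U₁, U₂, c, L₀)`, `0 < U₁ < U₂`, `0 < c`, if the window hypothesis holds (block
ground-state average of `Δ_d† Δ_d` at least `c L⁴` for all `U ∈ (U₁, U₂)` and all even `L ≥ L₀`),
then at SOME `U ∈ (U₁, U₂)` there are `a > 0` and `L₁` with `a L⁴ ≤ re ⟨ψ, Δ_d† Δ_d ψ⟩` for every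
normalised ground state `ψ` of `hubbardTorus 2 L 1 U` in the sector `(2⌊(1-δ)L²/2⌋, S^z = 0)` at
every even side `L ≥ L₁`. (⇐: `averageToEvery_of_everyGroundState_transfer`; ⇒: apply the crux and
convert the long-range order of every admissible sequence at the produced coupling by
`groundState_bound_of_forall_hasLRO` when `δ ≥ -1`; for `δ < -1` there are no sector ground states
eventually, `not_isGroundStateInSector_of_lt_neg_one`.) Scalapino, Phys. Rep. 250 (1995) 329, §2
eq. (2.4); Friedli–Velenik (2017) §3.7.2. [folklore] -/
theorem averageToEvery_iff_transfer :
    Summit.HubbardSuperconductivity.HubbardSuperconductivity.Theses.LogColdTorus.AverageToEvery ↔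
    (∀ (δ U₁ U₂ c : ℝ) (L₀ : ℕ), 0 < U₁ → U₁ < U₂ → 0 < c →
      (∀ U ∈ Set.Ioo U₁ U₂, ∀ (L : ℕ) [NeZero L], L₀ ≤ L → Even L →
        c * (L : ℝ) ^ 4 ≤ (((hubbardTorus 2 L 1 U).toBlock
          (fun s : Finset (Orb (FermionTorus 2 L)) => s.card = 2 * ⌊(1 - δ) * (L : ℝ) ^ 2 / 2⌋₊ ∧
            2 * (s.filter fun i => (ofLex i).2 = 0).card = 2 * ⌊(1 - δ) * (L : ℝ) ^ 2 / 2⌋₊)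
          (fun s : Finset (Orb (FermionTorus 2 L)) => s.card = 2 * ⌊(1 - δ) * (L : ℝ) ^ 2 / 2⌋₊ ∧
            2 * (s.filter fun i => (ofLex i).2 = 0).card = 2 * ⌊(1 - δ) * (L : ℝ) ^ 2 / 2⌋₊)).groundStateFunctional
          ((((pairField dWaveFormFactor L)ᴴ * pairField dWaveFormFactor L)).toBlock
          (fun s : Finset (Orb (FermionTorus 2 L)) => s.card = 2 * ⌊(1 - δ) * (L : ℝ) ^ 2 / 2⌋₊ ∧
            2 * (s.filter fun i => (ofLex i).2 = 0).card = 2 * ⌊(1 - δ) * (L : ℝ) ^ 2 / 2⌋₊)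
          (fun s : Finset (Orb (FermionTorus 2 L)) => s.card = 2 * ⌊(1 - δ) * (L : ℝ) ^ 2 / 2⌋₊ ∧
            2 * (s.filter fun i => (ofLex i).2 = 0).card = 2 * ⌊(1 - δ) * (L : ℝ) ^ 2 / 2⌋₊))).re) →
      ∃ U ∈ Set.Ioo U₁ U₂, ∃ a : ℝ, 0 < a ∧ ∃ L₁ : ℕ, ∀ (L : ℕ) [NeZero L], L₁ ≤ L → Even L →
        ∀ ψ : Fock (Orb (FermionTorus 2 L)),
          IsGroundStateInSector (hubbardTorus 2 L 1 U) (2 * ⌊(1 - δ) * (L : ℝ) ^ 2 / 2⌋₊) 0 ψ →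
          star ψ ⬝ᵥ ψ = 1 →
          a * (L : ℝ) ^ 4 ≤
            (star ψ ⬝ᵥ ((pairField dWaveFormFactor L)ᴴ * pairField dWaveFormFactor L) *ᵥ ψ).re) := by
  constructor
  · intro h δ U₁ U₂ c L₀ hU₁ hU₁₂ hc hyp
    obtain ⟨U, hU, hall⟩ := h δ U₁ U₂ c L₀ hU₁ hU₁₂ hc hyp
    by_cases hδ : -1 ≤ δ
    · exact ⟨U, hU, groundState_bound_of_forall_hasLRO U δ hδ hall⟩
    · -- `δ < -1`: no sector ground states from some side on, the bound is vacuous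
      obtain ⟨L₁, hL₁⟩ := not_isGroundStateInSector_of_lt_neg_one (not_le.mp hδ)
      exact ⟨U, hU, 1, one_pos, L₁, fun L _ hL _ ψ hgs _ => (hL₁ L hL _ ψ hgs).elim⟩
  · exact averageToEvery_of_everyGroundState_transfer

end Summit.HubbardSuperconductivity.HubbardSuperconductivity.Theorems

end
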